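import Mathlib
import Summits.NavierStokesRegularity.NavierStokesRegularity.Theorems.LerayQuarterDissipationFiniteDissipationLiouvilleLambProductCollar
import Literature.Analysis.FluidPDE.LeraySelfSimilarCalculus
import Literature.Analysis.FluidPDE.CKNInterpolationEstimate
import Summits.NavierStokesRegularity.NavierStokesRegularity.Theorems.TaoForcedUniqueness.Negative.CountableJunkProfile
import HarnessLib

/-!
# Crux `FiniteDissipationLiouville` (stmt-NavierStokesRegularity-22144): THE LOCAL ENSTROPHY-BALANCE
# THRESHOLD IN STRETCHING FORM, file A (tools) — algebra, scaling and KNSS-closedness of the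
# hypothesis `ω·Sω ≤ θ(|∇ω|² + |ω|²/(4(−t)))`

Theorems file of route `LerayQuarterDissipation` (lead prover g18; `--supports` the crux; sequel of
`…LocalBalance`; the threshold theorem is in file B `…LocalBalanceStretching`). Navier–Stokes
regularity is NOT proved by anything here; no summit is.

`…LocalBalance` uses the LAMB form `⟪U, Ω × curl Ω⟫` of the enstrophy production (from lead g17's
budget `…CrossFlowDss`). The two pointwise production densities `⟪Ω, ∇U Ω⟫ = ω·Sω` (stretching) and
`⟪U, Ω × curl Ω⟫` differ by a divergence, so a POINTWISE threshold in one form is not a pointwise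
threshold in the other. This file runs the same scheme on the STRETCHING form, with pub-ns-dss's
original identity `½Z' = −∫|∇Ω|²_F − ¼Z + ∫⟪Ω, ∇U Ω⟫` (`…SimilarityEnstrophyIdentity.similarityEnstrophy_hasDerivAt`):

* **`eq_zero_of_stretchingBalance`** — **every KNSS-gauge Type-I ancient mild field with a Type-I
  envelope such that `⟪ω, ∇u ω⟫ ≤ |∇ω|²_F + ‖ω‖²/(4(−t))` at every `t < 0`, `x` (vortex stretching
  never exceeds the local dissipation density plus the scale-invariant quarter of `‖ω‖²/(−t)`)
  VANISHES IDENTICALLY.** Rigidity: in the equality case `|∇Ω|²_F + ¼‖Ω‖² = ⟪Ω, ∇U Ω⟫ ≤ ‖∇U‖‖Ω‖²`, and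
  the class-uniform gradient decay `‖∇U(s,y)‖ ≤ K₁(1+‖y‖)⁻²` (KNSS) makes `‖∇U‖ < ¼` outside a ball, so
  the vorticity vanishes there, hence everywhere (analyticity). Compare the tree's stretching-RATE
  row (`ClockStretchingLaw`, `(−t)⟪Sξ,ξ⟫ ≤ θ < 1 ⇒ 0`, maximum principle): here ANY stretching rate is
  allowed where it is paid by local vorticity gradients, but only a quarter where it is not;
* `stretchingBalance_nsRescale`, `stretchingBalance_sim_of_phys`, `stretchingBalance_closed_of_tendsto`
  — scale invariance (`|c•L|²_F = c²|L|²_F`), similarity form, KNSS-closedness;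
* **`exists_stretchingBalance_gap`**, **`stretching_excess_of_singular`** — the COLLAR `1 + ε(C)` and
  the PORTRAIT: the hypothetical singular profile has a space–time point with
  `(1+ε)(|∇ω|²_F + ‖ω‖²/(4(−t))) < ⟪ω, ∇u ω⟫`.

HONEST FRAMING. The sharp pointwise form of the unweighted similarity-enstrophy method; silent when a
local stretching excess is compensated elsewhere (the generic case); `ε` ineffective. Necessary
conditions on a HYPOTHETICAL object; nothing is removed from the catalogued DSS wall beyond this
sub-class; verdict of the line unchanged (FRONTIER). Nothing here bears on Navier–Stokes regularity.

References: Koch–Nadirashvili–Seregin–Šverák, Acta Math. 203 (2009) §4, Prop. 4.1; Majda–Bertozzi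
(2002) §1.2 (enstrophy production `ω·Sω`); Lemarié-Rieusset (2016) Thm 9.12.
-/

noncomputable section

set_option linter.dupNamespace false

namespace Summit.NavierStokesRegularity.NavierStokesRegularity.Theorems.FiniteDissipationLiouville.LocalBalance

open MeasureTheory Set Filter Topology Metric InnerProductSpace Function Real
open scoped RealInnerProductSpace ContDiff
open Literature.Analysis Literature.Analysis.FluidPDE
open Summit.NavierStokesRegularity.NavierStokesRegularity.Theorems
open Summit.NavierStokesRegularity.NavierStokesRegularity.Theorems.GaussianGap
open Summit.NavierStokesRegularity.NavierStokesRegularity.Theorems.SimilarityEnstrophy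
open Summit.NavierStokesRegularity.NavierStokesRegularity.Theorems.RecurrentReductionD
open Summit.NavierStokesRegularity.NavierStokesRegularity.Theorems.FiniteDissipationLiouville
open Summit.NavierStokesRegularity.NavierStokesRegularity.Theorems.FiniteDissipationLiouville.CrossFlow
open Summit.NavierStokesRegularity.NavierStokesRegularity.Theorems.FiniteDissipationLiouville.EndpointScheme
open Summit.NavierStokesRegularity.NavierStokesRegularity.Theorems.FiniteDissipationLiouville.LambProduct

variable {C : ℝ} {V : ℝ → EuclideanSpace ℝ (Fin 3) → EuclideanSpace ℝ (Fin 3)}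

/-! ### Algebra -/

section Algebra

/-- **A small velocity gradient cannot balance**: `|G|²_F + ¼‖Ω‖² ≤ ⟪Ω, L Ω⟫` with `‖L‖ < ¼` forces
`Ω = 0` (`⟪Ω, LΩ⟫ ≤ ‖L‖‖Ω‖²`). [folklore] -/
theorem eq_zero_of_stretchingBalance_le_of_opNorm_lt {Ω : EuclideanSpace ℝ (Fin 3)}
    {L G : EuclideanSpace ℝ (Fin 3) →L[ℝ] EuclideanSpace ℝ (Fin 3)}
    (h : frobeniusNormSq G + (1 / 4) * ‖Ω‖ ^ 2 ≤ ⟪Ω, L Ω⟫) (hL : ‖L‖ < 1 / 4) : Ω = 0 := by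
  by_contra hne
  have hpos : 0 < ‖Ω‖ := norm_pos_iff.2 hne
  have hle : ⟪Ω, L Ω⟫ ≤ ‖L‖ * ‖Ω‖ ^ 2 := by
    calc ⟪Ω, L Ω⟫ ≤ ‖Ω‖ * ‖L Ω‖ := real_inner_le_norm _ _
      _ ≤ ‖Ω‖ * (‖L‖ * ‖Ω‖) := mul_le_mul_of_nonneg_left (L.le_opNorm Ω) (norm_nonneg _)
      _ = ‖L‖ * ‖Ω‖ ^ 2 := by ring
  have hG := frobeniusNormSq_nonneg G
  have h2 : 0 < (1 / 4 - ‖L‖) * ‖Ω‖ ^ 2 := mul_pos (by linarith) (by positivity)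
  nlinarith

end Algebra

/-! ### Scaling bookkeeping -/

section Scaling

/-- **The stretching balance is scale invariant.** [folklore] -/
theorem stretchingBalance_nsRescale {c θ : ℝ} (hc : 0 < c)
    (hP : ∀ t < 0, ∀ x, ⟪curl (V t) x, fderiv ℝ (V t) x (curl (V t) x)⟫ ≤
      θ * (frobeniusNormSq (fderiv ℝ (curl (V t)) x) + ‖curl (V t) x‖ ^ 2 / (4 * (-t)))) :
    ∀ t < 0, ∀ x, ⟪curl (nsRescale c V t) x, fderiv ℝ (nsRescale c V t) x (curl (nsRescale c V t) x)⟫ ≤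
      θ * (frobeniusNormSq (fderiv ℝ (curl (nsRescale c V t)) x) +
        ‖curl (nsRescale c V t) x‖ ^ 2 / (4 * (-t))) := by
  intro t ht x
  have hct : c ^ 2 * t < 0 := mul_neg_of_pos_of_neg (by positivity) ht
  have key := hP (c ^ 2 * t) hct (c • x)
  have hcurl : curl (nsRescale c V t) x = (c * c) • curl (V (c ^ 2 * t)) (c • x) := by
    rw [curl_eq_curlCLM, fderiv_nsRescale, map_smul, ← curl_eq_curlCLM]
  rw [hcurl, fderiv_nsRescale, fderiv_curl_nsRescale, Summit.NavierStokesRegularity.ForcedUniquenessCountableJunk.frobeniusNormSq_smul,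
    _root_.smul_apply, map_smul, real_inner_smul_left,
    real_inner_smul_right, real_inner_smul_right, norm_smul,
    Real.norm_of_nonneg (by positivity : (0:ℝ) ≤ c * c)]
  have ht' : 0 < -t := neg_pos.2 ht
  have h4 : (4 : ℝ) * (-t) ≠ 0 := by positivity
  have h4c : (4 : ℝ) * (-(c ^ 2 * t)) ≠ 0 := by
    rw [show (4 : ℝ) * (-(c ^ 2 * t)) = c ^ 2 * (4 * (-t)) by ring]; positivity
  have e1 : (c * c * ‖curl (V (c ^ 2 * t)) (c • x)‖) ^ 2 / (4 * (-t)) =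
      c ^ 6 * (‖curl (V (c ^ 2 * t)) (c • x)‖ ^ 2 / (4 * (-(c ^ 2 * t)))) := by
    rw [mul_div_assoc', div_eq_div_iff h4 h4c]
    ring
  rw [e1]
  have hw : 0 ≤ c ^ 6 := by positivity
  calc c * c * (c * c * (c * c *
        ⟪curl (V (c ^ 2 * t)) (c • x), fderiv ℝ (V (c ^ 2 * t)) (c • x) (curl (V (c ^ 2 * t)) (c • x))⟫))
      = c ^ 6 * ⟪curl (V (c ^ 2 * t)) (c • x),
          fderiv ℝ (V (c ^ 2 * t)) (c • x) (curl (V (c ^ 2 * t)) (c • x))⟫ := by ring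
    _ ≤ c ^ 6 * (θ * (frobeniusNormSq (fderiv ℝ (curl (V (c ^ 2 * t))) (c • x)) +
          ‖curl (V (c ^ 2 * t)) (c • x)‖ ^ 2 / (4 * (-(c ^ 2 * t))))) :=
        mul_le_mul_of_nonneg_left key hw
    _ = θ * ((c * c * c) ^ 2 * frobeniusNormSq (fderiv ℝ (curl (V (c ^ 2 * t))) (c • x)) +
          c ^ 6 * (‖curl (V (c ^ 2 * t)) (c • x)‖ ^ 2 / (4 * (-(c ^ 2 * t))))) := by ring

/-- **The stretching balance in similarity variables**: the physical hypothesis gives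
`⟪Ω, ∇U Ω⟫ ≤ θ(|∇Ω|²_F + ¼‖Ω‖²)` on the Leray orbit (all terms scale by `(−t)³`). [folklore] -/
theorem stretchingBalance_sim_of_phys {θ : ℝ}
    (hP : ∀ t < 0, ∀ x, ⟪curl (V t) x, fderiv ℝ (V t) x (curl (V t) x)⟫ ≤
      θ * (frobeniusNormSq (fderiv ℝ (curl (V t)) x) + ‖curl (V t) x‖ ^ 2 / (4 * (-t))))
    (s : ℝ) (y : EuclideanSpace ℝ (Fin 3)) :
    ⟪lerayVorticity V s y, fderiv ℝ (lerayOrbit V s) y (lerayVorticity V s y)⟫ ≤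
      θ * (frobeniusNormSq (fderiv ℝ (lerayVorticity V s) y) + (1 / 4) * ‖lerayVorticity V s y‖ ^ 2) := by
  have hl0 : 0 < Real.exp (-s / 2) := Real.exp_pos _
  have hk0 : 0 < Real.exp (-s) := Real.exp_pos _
  have ht0 : -Real.exp (-s) < 0 := neg_neg_of_pos hk0
  have hΩ : lerayVorticity V s y =
      Real.exp (-s) • curl (V (-Real.exp (-s))) (Real.exp (-s / 2) • y) := by
    rw [lerayVorticity_apply, curl_lerayOrbit]
  have hDU : fderiv ℝ (lerayOrbit V s) y =
      Real.exp (-s) • fderiv ℝ (V (-Real.exp (-s))) (Real.exp (-s / 2) • y) := fderiv_lerayOrbit V s y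
  have hDΩ : fderiv ℝ (lerayVorticity V s) y =
      (Real.exp (-s) * Real.exp (-s / 2)) • fderiv ℝ (curl (V (-Real.exp (-s)))) (Real.exp (-s / 2) • y) := by
    have hfun : lerayVorticity V s =
        fun z => Real.exp (-s) • curl (V (-Real.exp (-s))) (Real.exp (-s / 2) • z) := by
      funext z
      rw [lerayVorticity_apply, curl_lerayOrbit]
    rw [hfun, fderiv_const_smul_comp_smul']
  have h := hP _ ht0 (Real.exp (-s / 2) • y)
  rw [neg_neg] at h
  set w₀ : EuclideanSpace ℝ (Fin 3) := curl (V (-Real.exp (-s))) (Real.exp (-s / 2) • y) with hw₀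
  set L := fderiv ℝ (V (-Real.exp (-s))) (Real.exp (-s / 2) • y) with hL
  set G := fderiv ℝ (curl (V (-Real.exp (-s)))) (Real.exp (-s / 2) • y) with hG
  have hee : Real.exp (-s / 2) * Real.exp (-s / 2) = Real.exp (-s) := by
    rw [← Real.exp_add]; congr 1; ring
  have eL : ⟪lerayVorticity V s y, fderiv ℝ (lerayOrbit V s) y (lerayVorticity V s y)⟫ =
      Real.exp (-s) ^ 3 * ⟪w₀, L w₀⟫ := by
    rw [hΩ, hDU, _root_.smul_apply, map_smul, real_inner_smul_left,
      real_inner_smul_right, real_inner_smul_right]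
    ring
  have eR : frobeniusNormSq (fderiv ℝ (lerayVorticity V s) y) + (1 / 4) * ‖lerayVorticity V s y‖ ^ 2 =
      Real.exp (-s) ^ 3 * (frobeniusNormSq G + ‖w₀‖ ^ 2 / (4 * Real.exp (-s))) := by
    rw [hDΩ, Summit.NavierStokesRegularity.ForcedUniquenessCountableJunk.frobeniusNormSq_smul, hΩ, norm_smul, Real.norm_of_nonneg hk0.le]
    have e3 : Real.exp (-s) ^ 3 * (‖w₀‖ ^ 2 / (4 * Real.exp (-s))) = Real.exp (-s) ^ 2 * ‖w₀‖ ^ 2 / 4 := by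
      rw [mul_div_assoc', div_eq_div_iff (by positivity) (by norm_num)]
      ring
    calc (Real.exp (-s) * Real.exp (-s / 2)) ^ 2 * frobeniusNormSq G + 1 / 4 * (Real.exp (-s) * ‖w₀‖) ^ 2
        = Real.exp (-s) ^ 2 * (Real.exp (-s / 2) * Real.exp (-s / 2)) * frobeniusNormSq G +
            Real.exp (-s) ^ 2 * ‖w₀‖ ^ 2 / 4 := by ring
      _ = Real.exp (-s) ^ 3 * frobeniusNormSq G + Real.exp (-s) ^ 3 * (‖w₀‖ ^ 2 / (4 * Real.exp (-s))) := by
          rw [hee, e3]; ring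
      _ = Real.exp (-s) ^ 3 * (frobeniusNormSq G + ‖w₀‖ ^ 2 / (4 * Real.exp (-s))) := by ring
  rw [eL, eR, ← mul_assoc, mul_comm θ, mul_assoc]
  exact mul_le_mul_of_nonneg_left h (by positivity)

end Scaling

/-! ### Closedness under KNSS limits -/

section Closed

/-- **The stretching balance is closed under KNSS limits with moving constants.**
[cite: KochNadirashviliSereginSverak2009, Prop. 4.1 (arXiv:0709.3599 p. 8)] -/
theorem stretchingBalance_closed_of_tendsto {v : ℕ → ℝ → EuclideanSpace ℝ (Fin 3) → EuclideanSpace ℝ (Fin 3)}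
    {W : ℝ → EuclideanSpace ℝ (Fin 3) → EuclideanSpace ℝ (Fin 3)}
    (hv : ∀ j, IsTypeIAncientMild C (v j)) (hW : IsTypeIAncientMild C W)
    (hunif : ∀ n : ℕ, TendstoUniformlyOn (fun j z => v j z.1 z.2) (fun z => W z.1 z.2) atTop
      (Icc (-((n : ℝ) + 2)) (-(1 / ((n : ℝ) + 2))) ×ˢ
        closedBall (0 : EuclideanSpace ℝ (Fin 3)) ((n : ℝ) + 2)))
    (hgr : ∀ t < 0, ∀ x, Tendsto (fun j => fderiv ℝ (v j t) x) atTop (𝓝 (fderiv ℝ (W t) x)))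
    {θ : ℕ → ℝ} {θinf : ℝ} (hθ : Tendsto θ atTop (𝓝 θinf))
    (hP : ∀ j, ∀ t < 0, ∀ x, ⟪curl (v j t) x, fderiv ℝ (v j t) x (curl (v j t) x)⟫ ≤
        θ j * (frobeniusNormSq (fderiv ℝ (curl (v j t)) x) + ‖curl (v j t) x‖ ^ 2 / (4 * (-t)))) :
    ∀ t < 0, ∀ x, ⟪curl (W t) x, fderiv ℝ (W t) x (curl (W t) x)⟫ ≤
      θinf * (frobeniusNormSq (fderiv ℝ (curl (W t)) x) + ‖curl (W t) x‖ ^ 2 / (4 * (-t))) := by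
  intro t ht x
  obtain ⟨b, hb⟩ : ∃ b : ℕ → EuclideanSpace ℝ (Fin 3), ∀ j, b j = curl (v j t) x := ⟨_, fun j => rfl⟩
  obtain ⟨L, hL⟩ : ∃ L : ℕ → (EuclideanSpace ℝ (Fin 3) →L[ℝ] EuclideanSpace ℝ (Fin 3)),
      ∀ j, L j = fderiv ℝ (v j t) x := ⟨_, fun j => rfl⟩
  obtain ⟨G, hG⟩ : ∃ G : ℕ → (EuclideanSpace ℝ (Fin 3) →L[ℝ] EuclideanSpace ℝ (Fin 3)),
      ∀ j, G j = fderiv ℝ (curl (v j t)) x := ⟨_, fun j => rfl⟩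
  have htb : Tendsto b atTop (𝓝 (curl (W t) x)) :=
    (tendsto_curl_of_fderiv (hgr t ht x)).congr fun j => (hb j).symm
  have htL : Tendsto L atTop (𝓝 (fderiv ℝ (W t) x)) := (hgr t ht x).congr fun j => (hL j).symm
  have htG : Tendsto G atTop (𝓝 (fderiv ℝ (curl (W t)) x)) :=
    (tendsto_fderiv_curl_of_unif hv hW hunif ht x).congr fun j => (hG j).symm
  -- `L_j b_j → L b` (joint continuity of evaluation)
  have hLb : Tendsto (fun j => L j (b j)) atTop (𝓝 (fderiv ℝ (W t) x (curl (W t) x))) := by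
    have h := ((ContinuousLinearMap.apply ℝ (EuclideanSpace ℝ (Fin 3)) (curl (W t) x)).continuous.tendsto
      (fderiv ℝ (W t) x)).comp htL
    -- `L_j b_j - L_j b = L_j (b_j - b)`, `‖L_j‖` bounded
    have hdiff : Tendsto (fun j => L j (b j) - L j (curl (W t) x)) atTop (𝓝 0) := by
      have hbd : ∀ j, ‖L j (b j) - L j (curl (W t) x)‖ ≤ ‖L j‖ * ‖b j - curl (W t) x‖ := by
        intro j
        rw [← map_sub]
        exact (L j).le_opNorm _
      have h1 : Tendsto (fun j => ‖L j‖ * ‖b j - curl (W t) x‖) atTop (𝓝 0) := by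
        have := htL.norm.mul (tendsto_iff_norm_sub_tendsto_zero.1 htb)
        simpa using this
      exact squeeze_zero_norm hbd h1
    have hsum := h.add hdiff
    simp only [Function.comp, ContinuousLinearMap.apply_apply, add_zero] at hsum
    exact hsum.congr fun j => by abel
  have hLHS : Tendsto (fun j => ⟪b j, L j (b j)⟫) atTop
      (𝓝 ⟪curl (W t) x, fderiv ℝ (W t) x (curl (W t) x)⟫) := htb.inner hLb
  have hRHS : Tendsto (fun j => θ j * (frobeniusNormSq (G j) + ‖b j‖ ^ 2 / (4 * (-t)))) atTop
      (𝓝 (θinf * (frobeniusNormSq (fderiv ℝ (curl (W t)) x) + ‖curl (W t) x‖ ^ 2 / (4 * (-t))))) :=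
    hθ.mul (((continuous_frobeniusNormSq'.tendsto _).comp htG).add ((htb.norm.pow 2).div_const _))
  exact le_of_tendsto_of_tendsto' hLHS hRHS fun j => by rw [hb, hL, hG]; exact hP j t ht x

end Closed

end Summit.NavierStokesRegularity.NavierStokesRegularity.Theorems.FiniteDissipationLiouville.LocalBalance

end
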